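import Summits.QuantumFields.BalabanUV.Beta.NVertexColumnK1RowTorus
import Summits.QuantumFields.BalabanUV.Beta.FP.TowerK1RowTopCoefficients

/-!
# `BalabanUV.Beta.FP.TowerK1RowTopColumn` — road «FP», binder row D1, ROUTE T (β1): **THE END WRAPPER's (K1) ROW DISCHARGED AT THE FINEST LEVEL FOR THE
# ROAD's TOP DATA** — `cf (n+1) :=` the straight-chart multiplier coefficients transported in their SLOT index (an2 g63 J-NOTE-1 (b)), `w (n+1) := −c·(Lc⁴)^{n+2}`,
# along EVERY direction `hb (n+1) v = hv v` decomposed per source slot by (J-W″) (`hv e_a = colN̂_a − tgrad·λ_a`, g39 #5), MODULO the displayed (J-Λ-fold) of an2's PART 25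

WHY (`HOME/b2b-balaban-beta-d1-p3/g40/SPEC-51.md` §D∕§F∕§G; an2 g63 J-NOTE-1 l.67433, W-3 l.67480; road g41 ONLINE l.67484 ∕ A-1 l.67486).  The v4 END wrapper
`FP/StepRecursionFeedNestedNamedC.d1Tel_JcComp_ctr_namedC` (p538144) DISPLAYS, per depth `n` and box, the H-side storey data `cf w κ hb` and the row
`K1 : ∀ v u, c·((perF T (bhKStepAt 3 ρH Lc 0))|ff *ᵥ hb (n+1) v) u = w (n+1)·Σ_ā hb (n+1) v ā·Σ_μ Σ'_y (Σ'_m cf (n+1) μ (translate (Ma (n+1)) y m) ā.2 ā.1)·symLinKerAt ρ_c Lc μ y (u.2,u.1)`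
(`T = towerTorus Lc (fine Lc (Mc B)) (n+1)`).  an2 g63 PART 24 `NVertexColumnK1RowTorus.perF_ff_mulVec_perF_AN_eq_K1_shape` typed BOTH SIDES of this row for the
direction `colN̂` (the torus column of the composite one-shot chart `AN R (n+1)`, `hLN`-identified) with the weight `λ̂′ᴿ_0` (J-NOTE-1) and `α = −(Lc⁴)^{n+2}`; the row's PART 25
(W-3) types the (J-Λ-fold) `Σ_ā colN̂ ā·ĉf(κ₁,s₁)(ā) = λ̂′ᴿ_0(κ₁,s₁)` (γ = 1) for J-NOTE-1 (b)'s `cf`.  THIS FILE is the road's (β)(γ) + instantiation glue: it turns those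
two identities into the wrapper's K1 row AS DISPLAYED — for every `v`, along the actual direction `hv v` (the nested composite column, whose per-slot values are
`colN̂_a` PLUS an exact part `tgrad·λ_a`, R-FP-79 ∕ (J-W″)), with the road's scalars.

WHAT ([folklore] finite-sum bookkeeping BY NAME; no `def`, no `def … : Prop`, nothing cited, 0 sorry; ONE theorem — its lemmas are `FP/TowerK1RowTopCoefficients`:
the top table's two-scale covariance and (F1) `tsum_cfTop_translate_eq`, `hcf` at the top, (β) on both sides `ff_mul_exact_sum_eq_zero` ∕ `sum_exact_mul_tsum_cfTop_eq_zero`,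
the exchange `sum_mul_sum_tsum_mul_symLinKerAt_comm`, the basis read-off `apply_eq_sum_mul_single_of_linear`):
* **`K1_row_top`** — THE WRAPPER's K1 ROW at level `n+1` for: `T′` with `towerTorus Lc (fine Lc M) (n+1) i = Lc·T′ i` (the wrapper's `hMa`), `ρH = toSite rH` (`rH ∈ box 4 Lc`),
  `w₁ = −c·((Lc:ℝ)^(3+1))^(n+1+1)`, `cf₁ = cfTop` pointwise (`cfTop κ₁ s κ′ x := Σ_ν Σ'_w lamCoeffOf (KInv L) L ν w κ′ x·compLinKer (symLinKerAt (toSite R.r) Lc) Lc (n+1) (κ₁,s) (ν,w)`,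
  `L = Lc^(n+2)`, written out), ANY slot type `κ` with labels `yN μN` (the wrapper's `fN a = (wrapPt T (L•yN a), inr (μN a))`, `hcN`), ANY linear `hv` with the (J-W″) row
  `hJW` DISPLAYED (g39 `TorusWJunctionOfNLeg.hv_single_apply_eq_of_NLeg_sym`'s conclusion at `r := 1`, `λ` free) and the (J-Λ-fold) `hfold` DISPLAYED in an2 W-3's
  statement VERBATIM (an2 PART 25 `NVertexLamFold.sum_perF_AN_mul_periodised_cf_eq_tower` at `j := n+1` discharges it by name): conclusion = the wrapper's `K1 n B`
  (character-identical body, leaf-03 X-FPTK) with `hb n B (n+1) := hv n B` (`hbtop`), `w n (n+1) := w₁`, `cf n B (n+1) := cf₁`, `Ma n B (n+1) := T′`, and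
  `toSite R.r ≡ toSite (ctrOff 4 Lc)` at `R := Roots.ctr Lc` (`Roots.ctr_r`, rfl).  Proof: `T′ = towerTorus Lc M (n+1)` (`hT′`); both sides are `v`-linear, read off the basis
  slots; per slot `hJW` splits `hv e_a = colN̂_a − tgrad·λ_a`; LEFT = an2 PART 24 `perF_ff_mulVec_perF_AN_eq_K1_shape_tower` on the column and (β)-left on the gauge; RIGHT = the
  exchange, `hfold` on the column and (β)-right on the gauge; `hw₁`; `ring`.  (γ): `w (n+1) = −c·(Lc⁴)^{n+2}`, γ = 1, NO constraint on `c`.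
WHAT THIS IS NOT: not (J-Λ-fold) (an2 PART 25), not `hlink` ∕ the lower levels (road INTENT-3: `cf k := δ`, `hb k :=` the slot weights, PART 18 verbatim), not `hΛN` ∕ `hHN₁`;
no row of the END wrapper discharged AS CONTENT beyond K1-at-the-top MODULO `hfold ∕ hJW`; 0 estimates; nothing of Bałaban's asserted, valued or discharged; 0∕4 row-D1
binders (hW, hR, D1Tel, D1Rep); ROOT M‴ p325680 ∕ P5c ∕ D6 untouched; NOT (C1), NOT (L2′), NOT (T-ID), NOT SDF, NOT D1, NEVER «G-an2-4 closed», NOT BetaPertH, NOT continuum, NOT Clay.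

HONEST DEPENDENCY (page 1, mandatory): continuum YM on T⁴ ⇐ BetaPertH ∧ nine spine estimates (0/9 proved); BetaPertH ⇐ (D1) ∧ (D4) ∧ CAP+tail;
G-an2-4 gates asym, D1 and NE2/3/4.  HONEST FRAMING (cell contract, verbatim): «discharging `BetaPertH` makes Bałaban's UV stability UNCONDITIONAL —
a real constructive-QFT result; it is NOT the continuum limit and NOT the Clay problem.»  ABSOLUTE RULE (cell charter, verbatim): «No internally-minted
statement may enter as a cited fact. Every hypothesis is either kernel-proved in this package or a verbatim quotation of a PUBLISHED theorem with page
reference. The manuscript(s) under audit are NOT citable for their own disputed steps — they are the thing under adjudication; programme-internal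
(2001/route/tribunal) claims are never citable.»  Road «FP» OWNER, b2b-balaban-beta-d1-p3 gen 41, 2026-08-27.  No existing file touched.
-/

noncomputable section

open scoped BigOperators

namespace Summit.QuantumFields.BalabanUV.Beta.FP.TowerK1RowTopColumn

open Finset
open Literature.MathematicalPhysics.QuantumFieldTheory
open Literature.MathematicalPhysics.QuantumFieldTheory.Balaban1983to89
open Literature.MathematicalPhysics.QuantumFieldTheory.Balaban1983to89.Beta
open B4TorusKernel.MultiPeriod (translate)
open B5Prop11Plancherel (fine)
open B6Lemma24Torus (pbox)
open AffineAveraging (Site box toSite)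
open AveragingHessianKernels (Bond)
open OneStepResolventKernel (Fib KInv)
open BalabanStepJets (lamCoeffOf)
open Summit.QuantumFields.BalabanUV.Beta.SymAveragingHessianCounts (symLinKerAt)
open Summit.QuantumFields.BalabanUV.Beta.CompositeVertexKernelRec (compLinKer)
open Summit.QuantumFields.BalabanUV.Beta.CompositeOneShotJetData (Roots AN)
open Summit.QuantumFields.BalabanUV.Beta.BorderedHessian (bhKStepAt)
open Summit.QuantumFields.BalabanUV.Beta.FP.KernelPeriodisationFib (Idx perF)
open Summit.QuantumFields.BalabanUV.Beta.FP.TorusCompositeObjects (towerTorus)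
open Summit.QuantumFields.BalabanUV.Beta.FP.TorusGaugeCovariance (tgrad)
open Summit.QuantumFields.BalabanUV.Beta.FP.TorusGaugeCovariancePairing (wrapPt)
open Summit.QuantumFields.BalabanUV.Beta.NVertexLamCorePeriodised (towerTorus_fine_apply_eq)
open Summit.QuantumFields.BalabanUV.Beta.NVertexColumnK1RowTorus (perF_ff_mulVec_perF_AN_eq_K1_shape_tower pow_dvd_towerTorus_fine)
open Summit.QuantumFields.BalabanUV.Beta.FP.TowerK1RowTopCoefficients (ff_mul_exact_sum_eq_zero sum_exact_mul_tsum_cfTop_eq_zero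
  sum_mul_sum_tsum_mul_symLinKerAt_comm apply_eq_sum_mul_single_of_linear)

variable {Lc : ℕ} [NeZero Lc] (R : Roots Lc) (n : ℕ) (M : Fin (3 + 1) → ℕ) [∀ i, NeZero (M i)]

/-! ## The wrapper's (K1) row at the finest level -/

section K1

set_option maxHeartbeats 400000 in
/-- [folklore] **`K1_row_top` — THE END WRAPPER's (K1) ROW AT LEVEL `n+1` FOR THE ROAD's TOP DATA, MODULO THE DISPLAYED (J-Λ-fold) AND (J-W″).**
On the bond torus `T = towerTorus Lc (fine Lc M) (n+1)` (the wrapper's, `M := Mc B`) with slot torus `T′` (`T i = Lc·T′ i` — the wrapper's `hMa` at `k = n+1`),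
root `ρH = toSite rH` (`rH ∈ box 4 Lc`), scalar `w₁ = −c·((Lc:ℝ)^(3+1))^(n+1+1)`, coefficient table `cf₁ = cfTop` pointwise (J-NOTE-1 (b)), ANY slot type `κ` with
labels `yN μN`, ANY linear direction map `hv` whose basis values are the torus column of the composite chart MINUS a torus pure gauge (`hJW`: g39
`TorusWJunctionOfNLeg.hv_single_apply_eq_of_NLeg_sym`'s conclusion at `r := 1`), and the (J-Λ-fold) `hfold` (an2 W-3's statement, PART 25):
for every `v` and `u`,
`c·((perF T (bhKStepAt 3 ρH Lc 0))|ff *ᵥ hv v) u = w₁·Σ_ā hv v ā·Σ_μ Σ'_y (Σ'_m cf₁ μ (translate T′ y m) ā.2 ā.1)·symLinKerAt (toSite R.r) Lc μ y (u.2, u.1)` —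
the wrapper's `K1 n B v u` with `hb n B (n+1) := hv n B` (`hbtop` by `rfl`), `w n (n+1) := w₁`, `cf n B (n+1) := cf₁`, `Ma n B (n+1) := T′`, and `toSite R.r ≡ toSite (ctrOff 4 Lc)`
at `R := Roots.ctr Lc`.  Proof: §3 reads both sides off the basis slots; per slot, `hJW` splits `hv e_a = colN̂_a − tgrad·λ_a`; the column part is an2 PART 24
`perF_ff_mulVec_perF_AN_eq_K1_shape_tower` (left) against `hfold` (right, after §3's exchange); the gauge part vanishes on both sides (§2). -/
theorem K1_row_top (T' : Fin (3 + 1) → ℕ) (hT' : ∀ i, towerTorus Lc (fine Lc M) (n + 1) i = Lc * T' i)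
    {rH : Fin (3 + 1) → ℕ} (hrH : rH ∈ box (3 + 1) Lc) (ρH : Fin (3 + 1) → ℤ) (hρH : ρH = toSite rH)
    (c w₁ : ℝ) (hw₁ : w₁ = -(c * ((Lc : ℝ) ^ (3 + 1)) ^ (n + 1 + 1)))
    (cf₁ : Fin (3 + 1) → Site (3 + 1) → Fin (3 + 1) → Site (3 + 1) → ℝ)
    (hcf₁ : ∀ (κ₁ : Fin (3 + 1)) (s : Site (3 + 1)) (κ' : Fin (3 + 1)) (x : Site (3 + 1)), cf₁ κ₁ s κ' x
        = ∑ ν : Fin (3 + 1), ∑' w : Site (3 + 1), lamCoeffOf (KInv (N := Lc ^ (n + 1 + 1)) (d := 3)) (Lc ^ (n + 1 + 1)) ν w κ' x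
            * compLinKer (fun _ => symLinKerAt (toSite R.r) Lc) Lc (n + 1) (κ₁, s) (ν, w))
    {κ : Type*} [Fintype κ] [DecidableEq κ] (yN : κ → Site (3 + 1)) (μN : κ → Fin (3 + 1))
    (hv : (κ → ℝ) → (↥(pbox (towerTorus Lc (fine Lc M) (n + 1))) × Fin (3 + 1) → ℝ))
    (hhvl : ∀ (r : ℝ) (x y : κ → ℝ), hv (r • x + y) = r • hv x + hv y)
    (lam : κ → ↥(pbox (towerTorus Lc (fine Lc M) (n + 1))) → ℝ)
    (hJW : ∀ (a : κ) (b : ↥(pbox (towerTorus Lc (fine Lc M) (n + 1))) × Fin (3 + 1)), hv (Pi.single a 1) b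
        = perF (towerTorus Lc (fine Lc M) (n + 1)) (AN R (n + 1)) (b.1, Sum.inl b.2)
            (wrapPt (towerTorus Lc (fine Lc M) (n + 1)) (((Lc ^ (n + 1 + 1) : ℕ) : ℤ) • yN a), Sum.inr (μN a))
          - ∑ s : ↥(pbox (towerTorus Lc (fine Lc M) (n + 1))), tgrad (towerTorus Lc (fine Lc M) (n + 1)) (b.1, Sum.inl b.2) s * lam a s)
    (hfold : ∀ (μ : Fin (3 + 1)) (y : Site (3 + 1)) (κ₁ : Fin (3 + 1)) (s₁ : Site (3 + 1)),
        ∑ ā : ↥(pbox (towerTorus Lc (fine Lc M) (n + 1))) × Fin (3 + 1),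
            perF (towerTorus Lc (fine Lc M) (n + 1)) (AN R (n + 1)) (ā.1, Sum.inl ā.2)
                (wrapPt (towerTorus Lc (fine Lc M) (n + 1)) (((Lc ^ (n + 1 + 1) : ℕ) : ℤ) • y), Sum.inr μ)
              * (∑' m : Site (3 + 1), ∑ ν : Fin (3 + 1), ∑' w : Site (3 + 1),
                  lamCoeffOf (KInv (N := Lc ^ (n + 1 + 1)) (d := 3)) (Lc ^ (n + 1 + 1)) ν w ā.2 (ā.1 : Site (3 + 1))
                    * compLinKer (fun _ => symLinKerAt (toSite R.r) Lc) Lc (n + 1) (κ₁, translate T' s₁ m) (ν, w))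
          = ∑' m : Site (3 + 1), ∑ ν : Fin (3 + 1), ∑' w : Site (3 + 1),
              (∑ κ' : Fin (3 + 1), ∑' u' : Site (3 + 1),
                  AN R (n + 1) u' (((Lc ^ (n + 1 + 1) : ℕ) : ℤ) • y) (Sum.inl κ') (Sum.inr μ)
                    * lamCoeffOf (KInv (N := Lc ^ (n + 1 + 1)) (d := 3)) (Lc ^ (n + 1 + 1)) ν w κ' u')
                * compLinKer (fun _ => symLinKerAt (toSite R.r) Lc) Lc (n + 1) (κ₁, translate T' s₁ m) (ν, w))
    (v : κ → ℝ) (u : ↥(pbox (towerTorus Lc (fine Lc M) (n + 1))) × Fin (3 + 1)) :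
    c * ((perF (towerTorus Lc (fine Lc M) (n + 1)) (bhKStepAt 3 ρH Lc 0)).submatrix
          (fun b : ↥(pbox (towerTorus Lc (fine Lc M) (n + 1))) × Fin (3 + 1) =>
            ((b.1, Sum.inl b.2) : Idx (towerTorus Lc (fine Lc M) (n + 1)) (Fib 3)))
          (fun b : ↥(pbox (towerTorus Lc (fine Lc M) (n + 1))) × Fin (3 + 1) =>
            ((b.1, Sum.inl b.2) : Idx (towerTorus Lc (fine Lc M) (n + 1)) (Fib 3)))).mulVec (hv v) u
      = w₁ * ∑ ā : ↥(pbox (towerTorus Lc (fine Lc M) (n + 1))) × Fin (3 + 1), hv v ā *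
          ∑ μ : Fin (3 + 1), ∑' y : Site (3 + 1), (∑' m : Site (3 + 1), cf₁ μ (translate T' y m) ā.2 (ā.1 : Site (3 + 1)))
            * symLinKerAt (toSite R.r) Lc μ y (u.2, (u.1 : Site (3 + 1))) := by
  have hL : 0 < Lc := Nat.pos_of_ne_zero (NeZero.ne Lc)
  have hT'eq : T' = towerTorus Lc M (n + 1) := by
    funext i
    have h := hT' i
    rw [towerTorus_fine_apply_eq M (n + 1) i] at h
    exact (Nat.eq_of_mul_eq_mul_left hL h).symm
  subst hρH hT'eq
  -- the periodised tables, unfolded pointwise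
  have hg : ∀ (μ : Fin (3 + 1)) (y : Site (3 + 1)) (ā : ↥(pbox (towerTorus Lc (fine Lc M) (n + 1))) × Fin (3 + 1)),
      (∑' m : Site (3 + 1), cf₁ μ (translate (towerTorus Lc M (n + 1)) y m) ā.2 (ā.1 : Site (3 + 1)))
        = ∑' m : Site (3 + 1), ∑ ν : Fin (3 + 1), ∑' w : Site (3 + 1),
            lamCoeffOf (KInv (N := Lc ^ (n + 1 + 1)) (d := 3)) (Lc ^ (n + 1 + 1)) ν w ā.2 (ā.1 : Site (3 + 1))
              * compLinKer (fun _ => symLinKerAt (toSite R.r) Lc) Lc (n + 1) (μ, translate (towerTorus Lc M (n + 1)) y m) (ν, w) :=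
    fun μ y ā => tsum_congr fun m => hcf₁ μ _ ā.2 _
  -- both sides are linear functionals of `v`: read them off the basis slots
  have hlinL : ∀ (r : ℝ) (x y : κ → ℝ),
      c * ((perF (towerTorus Lc (fine Lc M) (n + 1)) (bhKStepAt 3 (toSite rH) Lc 0)).submatrix
          (fun b : ↥(pbox (towerTorus Lc (fine Lc M) (n + 1))) × Fin (3 + 1) =>
            ((b.1, Sum.inl b.2) : Idx (towerTorus Lc (fine Lc M) (n + 1)) (Fib 3)))
          (fun b : ↥(pbox (towerTorus Lc (fine Lc M) (n + 1))) × Fin (3 + 1) =>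
            ((b.1, Sum.inl b.2) : Idx (towerTorus Lc (fine Lc M) (n + 1)) (Fib 3)))).mulVec (hv (r • x + y)) u
        = r * (c * ((perF (towerTorus Lc (fine Lc M) (n + 1)) (bhKStepAt 3 (toSite rH) Lc 0)).submatrix
          (fun b : ↥(pbox (towerTorus Lc (fine Lc M) (n + 1))) × Fin (3 + 1) =>
            ((b.1, Sum.inl b.2) : Idx (towerTorus Lc (fine Lc M) (n + 1)) (Fib 3)))
          (fun b : ↥(pbox (towerTorus Lc (fine Lc M) (n + 1))) × Fin (3 + 1) =>
            ((b.1, Sum.inl b.2) : Idx (towerTorus Lc (fine Lc M) (n + 1)) (Fib 3)))).mulVec (hv x) u)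
          + c * ((perF (towerTorus Lc (fine Lc M) (n + 1)) (bhKStepAt 3 (toSite rH) Lc 0)).submatrix
          (fun b : ↥(pbox (towerTorus Lc (fine Lc M) (n + 1))) × Fin (3 + 1) =>
            ((b.1, Sum.inl b.2) : Idx (towerTorus Lc (fine Lc M) (n + 1)) (Fib 3)))
          (fun b : ↥(pbox (towerTorus Lc (fine Lc M) (n + 1))) × Fin (3 + 1) =>
            ((b.1, Sum.inl b.2) : Idx (towerTorus Lc (fine Lc M) (n + 1)) (Fib 3)))).mulVec (hv y) u := by
    intro r x y
    rw [hhvl, Matrix.mulVec_add, Matrix.mulVec_smul, Pi.add_apply, Pi.smul_apply, smul_eq_mul]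
    ring
  have hlinR : ∀ (r : ℝ) (x y : κ → ℝ),
      w₁ * (∑ ā : ↥(pbox (towerTorus Lc (fine Lc M) (n + 1))) × Fin (3 + 1), hv (r • x + y) ā *
          ∑ μ : Fin (3 + 1), ∑' y' : Site (3 + 1), (∑' m : Site (3 + 1), cf₁ μ (translate (towerTorus Lc M (n + 1)) y' m) ā.2 (ā.1 : Site (3 + 1)))
            * symLinKerAt (toSite R.r) Lc μ y' (u.2, (u.1 : Site (3 + 1))))
        = r * (w₁ * ∑ ā : ↥(pbox (towerTorus Lc (fine Lc M) (n + 1))) × Fin (3 + 1), hv x ā *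
          ∑ μ : Fin (3 + 1), ∑' y' : Site (3 + 1), (∑' m : Site (3 + 1), cf₁ μ (translate (towerTorus Lc M (n + 1)) y' m) ā.2 (ā.1 : Site (3 + 1)))
            * symLinKerAt (toSite R.r) Lc μ y' (u.2, (u.1 : Site (3 + 1))))
          + w₁ * ∑ ā : ↥(pbox (towerTorus Lc (fine Lc M) (n + 1))) × Fin (3 + 1), hv y ā *
          ∑ μ : Fin (3 + 1), ∑' y' : Site (3 + 1), (∑' m : Site (3 + 1), cf₁ μ (translate (towerTorus Lc M (n + 1)) y' m) ā.2 (ā.1 : Site (3 + 1)))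
            * symLinKerAt (toSite R.r) Lc μ y' (u.2, (u.1 : Site (3 + 1))) := by
    intro r x y
    rw [hhvl]
    simp only [Pi.add_apply, Pi.smul_apply, smul_eq_mul, add_mul, Finset.sum_add_distrib, mul_add, mul_assoc, ← Finset.mul_sum]
    ring
  rw [apply_eq_sum_mul_single_of_linear (fun x : κ → ℝ => c * ((perF (towerTorus Lc (fine Lc M) (n + 1)) (bhKStepAt 3 (toSite rH) Lc 0)).submatrix
          (fun b : ↥(pbox (towerTorus Lc (fine Lc M) (n + 1))) × Fin (3 + 1) =>
            ((b.1, Sum.inl b.2) : Idx (towerTorus Lc (fine Lc M) (n + 1)) (Fib 3)))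
          (fun b : ↥(pbox (towerTorus Lc (fine Lc M) (n + 1))) × Fin (3 + 1) =>
            ((b.1, Sum.inl b.2) : Idx (towerTorus Lc (fine Lc M) (n + 1)) (Fib 3)))).mulVec (hv x) u) hlinL v,
    apply_eq_sum_mul_single_of_linear (fun x : κ → ℝ => w₁ * ∑ ā : ↥(pbox (towerTorus Lc (fine Lc M) (n + 1))) × Fin (3 + 1), hv x ā *
          ∑ μ : Fin (3 + 1), ∑' y' : Site (3 + 1), (∑' m : Site (3 + 1), cf₁ μ (translate (towerTorus Lc M (n + 1)) y' m) ā.2 (ā.1 : Site (3 + 1)))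
            * symLinKerAt (toSite R.r) Lc μ y' (u.2, (u.1 : Site (3 + 1)))) hlinR v]
  refine Finset.sum_congr rfl fun a _ => ?_
  congr 1
  -- per source slot `a`: split the basis direction into the torus column and its pure gauge
  have hva : hv (Pi.single a 1)
      = (fun b : ↥(pbox (towerTorus Lc (fine Lc M) (n + 1))) × Fin (3 + 1) =>
          perF (towerTorus Lc (fine Lc M) (n + 1)) (AN R (n + 1)) (b.1, Sum.inl b.2)
            (wrapPt (towerTorus Lc (fine Lc M) (n + 1)) (((Lc ^ (n + 1 + 1) : ℕ) : ℤ) • yN a), Sum.inr (μN a)))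
        - (fun b : ↥(pbox (towerTorus Lc (fine Lc M) (n + 1))) × Fin (3 + 1) =>
          ∑ s : ↥(pbox (towerTorus Lc (fine Lc M) (n + 1))), tgrad (towerTorus Lc (fine Lc M) (n + 1)) (b.1, Sum.inl b.2) s * lam a s) :=
    funext fun b => by rw [hJW a b, Pi.sub_apply]
  rw [hva]
  -- LEFT: PART 24 on the column, §2 on the gauge
  have hcol := perF_ff_mulVec_perF_AN_eq_K1_shape_tower R (n + 1) M (n + 1) (pow_dvd_towerTorus_fine M (n + 1)) (toSite rH) (μN a) (yN a) u
  have hLHS : c * ((perF (towerTorus Lc (fine Lc M) (n + 1)) (bhKStepAt 3 (toSite rH) Lc 0)).submatrix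
          (fun b : ↥(pbox (towerTorus Lc (fine Lc M) (n + 1))) × Fin (3 + 1) =>
            ((b.1, Sum.inl b.2) : Idx (towerTorus Lc (fine Lc M) (n + 1)) (Fib 3)))
          (fun b : ↥(pbox (towerTorus Lc (fine Lc M) (n + 1))) × Fin (3 + 1) =>
            ((b.1, Sum.inl b.2) : Idx (towerTorus Lc (fine Lc M) (n + 1)) (Fib 3)))).mulVec
        ((fun b : ↥(pbox (towerTorus Lc (fine Lc M) (n + 1))) × Fin (3 + 1) =>
          perF (towerTorus Lc (fine Lc M) (n + 1)) (AN R (n + 1)) (b.1, Sum.inl b.2)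
            (wrapPt (towerTorus Lc (fine Lc M) (n + 1)) (((Lc ^ (n + 1 + 1) : ℕ) : ℤ) • yN a), Sum.inr (μN a)))
        - (fun b : ↥(pbox (towerTorus Lc (fine Lc M) (n + 1))) × Fin (3 + 1) =>
          ∑ s : ↥(pbox (towerTorus Lc (fine Lc M) (n + 1))), tgrad (towerTorus Lc (fine Lc M) (n + 1)) (b.1, Sum.inl b.2) s * lam a s)) u
      = c * (-((Lc : ℝ) ^ (3 + 1)) ^ (n + 1 + 1) * ∑ κ₁ : Fin (3 + 1), ∑' s₁ : Site (3 + 1),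
          (∑' m : Site (3 + 1), ∑ ν : Fin (3 + 1), ∑' w : Site (3 + 1),
              (∑ κ' : Fin (3 + 1), ∑' u' : Site (3 + 1),
                  AN R (n + 1) u' (((Lc ^ (n + 1 + 1) : ℕ) : ℤ) • yN a) (Sum.inl κ') (Sum.inr (μN a))
                    * lamCoeffOf (KInv (N := Lc ^ (n + 1 + 1)) (d := 3)) (Lc ^ (n + 1 + 1)) ν w κ' u')
                * compLinKer (fun _ => symLinKerAt (toSite R.r) Lc) Lc (n + 1) (κ₁, translate (towerTorus Lc M (n + 1)) s₁ m) (ν, w))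
            * symLinKerAt (toSite R.r) Lc κ₁ s₁ (u.2, (u.1 : Site (3 + 1)))) := by
    rw [Matrix.mulVec_sub, Pi.sub_apply]
    simp only [Matrix.mulVec, dotProduct, Matrix.submatrix_apply]
    rw [hcol, ff_mul_exact_sum_eq_zero hrH (towerTorus Lc (fine Lc M) (n + 1)) (lam a) u, sub_zero]
  -- RIGHT: §3's exchange, then `hfold` on the column and §2 on the gauge
  have hRHS : w₁ * ∑ ā : ↥(pbox (towerTorus Lc (fine Lc M) (n + 1))) × Fin (3 + 1),
        ((fun b : ↥(pbox (towerTorus Lc (fine Lc M) (n + 1))) × Fin (3 + 1) =>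
          perF (towerTorus Lc (fine Lc M) (n + 1)) (AN R (n + 1)) (b.1, Sum.inl b.2)
            (wrapPt (towerTorus Lc (fine Lc M) (n + 1)) (((Lc ^ (n + 1 + 1) : ℕ) : ℤ) • yN a), Sum.inr (μN a)))
        - (fun b : ↥(pbox (towerTorus Lc (fine Lc M) (n + 1))) × Fin (3 + 1) =>
          ∑ s : ↥(pbox (towerTorus Lc (fine Lc M) (n + 1))), tgrad (towerTorus Lc (fine Lc M) (n + 1)) (b.1, Sum.inl b.2) s * lam a s)) ā *
          ∑ μ : Fin (3 + 1), ∑' y' : Site (3 + 1), (∑' m : Site (3 + 1), cf₁ μ (translate (towerTorus Lc M (n + 1)) y' m) ā.2 (ā.1 : Site (3 + 1)))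
            * symLinKerAt (toSite R.r) Lc μ y' (u.2, (u.1 : Site (3 + 1)))
      = w₁ * ∑ κ₁ : Fin (3 + 1), ∑' s₁ : Site (3 + 1),
          (∑' m : Site (3 + 1), ∑ ν : Fin (3 + 1), ∑' w : Site (3 + 1),
              (∑ κ' : Fin (3 + 1), ∑' u' : Site (3 + 1),
                  AN R (n + 1) u' (((Lc ^ (n + 1 + 1) : ℕ) : ℤ) • yN a) (Sum.inl κ') (Sum.inr (μN a))
                    * lamCoeffOf (KInv (N := Lc ^ (n + 1 + 1)) (d := 3)) (Lc ^ (n + 1 + 1)) ν w κ' u')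
                * compLinKer (fun _ => symLinKerAt (toSite R.r) Lc) Lc (n + 1) (κ₁, translate (towerTorus Lc M (n + 1)) s₁ m) (ν, w))
            * symLinKerAt (toSite R.r) Lc κ₁ s₁ (u.2, (u.1 : Site (3 + 1))) := by
    rw [sum_mul_sum_tsum_mul_symLinKerAt_comm R (towerTorus Lc (fine Lc M) (n + 1)) _
      (fun μ y' ā => ∑' m : Site (3 + 1), cf₁ μ (translate (towerTorus Lc M (n + 1)) y' m) ā.2 (ā.1 : Site (3 + 1))) u]
    congr 1
    refine Finset.sum_congr rfl fun κ₁ _ => tsum_congr fun s₁ => ?_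
    congr 1
    simp only [Pi.sub_apply, sub_mul, Finset.sum_sub_distrib, hg]
    rw [hfold (μN a) (yN a) κ₁ s₁, sum_exact_mul_tsum_cfTop_eq_zero R n M κ₁ s₁ (lam a), sub_zero]
  rw [hLHS, hRHS, hw₁]
  ring

end K1

end Summit.QuantumFields.BalabanUV.Beta.FP.TowerK1RowTopColumn

end
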